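import Summits.Ventures.Crystal3D.Theorems.StickyWulffConstantCoaxialWallLawRigidLedger
import Summits.Ventures.Crystal3D.Theorems.StickyWulffConstantCoaxialWallLawTwinAbsorptionMoved
import Summits.Ventures.Crystal3D.Theorems.StickyWulffConstantCoaxialWallLawHaggConst
import Summits.Ventures.Crystal3D.Theorems.StickyWulffConstantGenericWallFloorCoaxialIff
import Summits.Ventures.Crystal3D.Theorems.StickyWulffConstantNoReconstructionGainLatticeAdhesion
import HarnessLib

/-!
# The rigid rung of `stub_coaxialTwoSlabAdhesion` for twin pairs without coincidence sites

HONEST FRAMING. Part of the venture `Summits/Ventures/Crystal3D` (cell `crystal3d-full`), helper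
`--supports` the crux `CoaxialWallLaw` (stmt-Ventures-19481, `route-Ventures-StickyWulffConstant`),
REGISTERED line `WallLedgerF` (planner cf-p1 gen 16), stub `stub_coaxialTwoSlabAdhesion`.
RUNG CREDIT ONLY: this is the stub's inequality under two extra hypotheses, not the stub.

**Theorem (`coaxialTwoSlabAdhesion_rigid_twin`).**  Let `Λᵢ = Aᵢ·Λ₀ + tᵢ` be a CO-AXIAL pair
(the crux's literal hypothesis: a common Barlow frame `L` with Hägg words `σ, σ'`) of moved fcc
lattices with DIFFERENT linear parts (`A₁·Λ₀ ≠ A₂·Λ₀` — a twin pair; in the common frame the two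
words are the two constant letters) and NO coincidence sites (`Λ₁ ∩ Λ₂ = ∅`, the non-CSL case).
Then the conclusion of `CoaxialTwoSlabAdhesion` holds for the same frame `L`, with `R₀ = 3` and an
explicit `C`, for every RIGID filling — every unit packing `X ⊆ Λ₁ ∪ Λ₂` of the clamped cylinder
cell containing the two complete slabs:

  `cross(P₁, X∖P₁) + cross(P₂, Y) ≤ D(Y) + (φ₁ + φ₂ − ½ √(1 − ⟪L e₃, e₃⟫²)) π ρ² + C (1 + h) ρ`,

`Y = (X∖P₁)∖P₂`.  In fact with `½` replaced by `√6/4 = 0.612…` (`coaxial_rigid_cell_ledger`).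

Proof = the terrace/riser slot ledger of this line, all landed: frame normalisation
(`coaxial_frame_eq_fcc_of_one/_neg_one`: the grains are `L·Λ₀ + s₁` and `(R∘L)·Λ₀ + s₂`, `R` the
half-turn, same axis `L e₃`), crude absorption for twin pairs (`twin_absorption_inPlane_moved/'`:
`vac_in + 4·deg ≤ 48` at every ball off the other grain — here every ball, no coincidence sites),
the two-grain cell ledger (`coaxial_rigid_cell_ledger`: outer faces by `outerCredits_ge`, wall by
the climbing riser count `upInPlane_vacancies_ge_sine`, sealing of the floor/ceiling, rim
`O((1+h)ρ)`), the slab samples' own deficiency from above (`affineSampleDeficit_upper`) and the two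
`contactDeficiency_sdiff_split` identities of the skeleton `WallLedgerF`.

WHAT THIS IS NOT: the stub (arbitrary fillings `X`, translation pairs, CSL twins are not covered);
rung F-C1 not moved.
-/

noncomputable section

namespace Summit.Ventures.Crystal3D.Theorems

open Summit.Ventures.Crystal3D Finset
open Literature.MathematicalPhysics.StatisticalMechanics (fccStacking barlowStacking IsHaggSeq
  contactDeficiency)
open scoped InnerProductSpace

/-- `2 ≤ √6`, i.e. the ledger's `√6/4` beats the crux's `½`. -/
theorem two_le_sqrt_six : (2 : ℝ) ≤ Real.sqrt 6 := by
  rw [show (2 : ℝ) = Real.sqrt (2 ^ 2) by rw [Real.sqrt_sq (by norm_num)]]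
  exact Real.sqrt_le_sqrt (by norm_num)

/-- **The rigid rung of `stub_coaxialTwoSlabAdhesion`, twin pairs without coincidence sites.**
See the module docstring. -/
theorem coaxialTwoSlabAdhesion_rigid_twin
    (A₁ : EuclideanSpace ℝ (Fin 3) ≃ₗᵢ[ℝ] EuclideanSpace ℝ (Fin 3)) (t₁ : EuclideanSpace ℝ (Fin 3))
    (A₂ : EuclideanSpace ℝ (Fin 3) ≃ₗᵢ[ℝ] EuclideanSpace ℝ (Fin 3)) (t₂ : EuclideanSpace ℝ (Fin 3))
    (hcoax : ∃ (L : EuclideanSpace ℝ (Fin 3) ≃ₗᵢ[ℝ] EuclideanSpace ℝ (Fin 3))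
        (s₁ s₂ : EuclideanSpace ℝ (Fin 3)) (σ σ' : ℤ → ℤ), IsHaggSeq σ ∧ IsHaggSeq σ' ∧
        (fun p => A₁ p + t₁) '' fccStacking 1 (Real.sqrt (2 / 3)) ⊆
          (fun p => L p + s₁) '' barlowStacking 1 (Real.sqrt (2 / 3)) σ ∧
        (fun p => A₂ p + t₂) '' fccStacking 1 (Real.sqrt (2 / 3)) ⊆
          (fun p => L p + s₂) '' barlowStacking 1 (Real.sqrt (2 / 3)) σ')
    (htwin : A₁ '' fccStacking 1 (Real.sqrt (2 / 3)) ≠ A₂ '' fccStacking 1 (Real.sqrt (2 / 3)))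
    (hdisj : ∀ p ∈ (fun q => A₁ q + t₁) '' fccStacking 1 (Real.sqrt (2 / 3)),
      p ∉ (fun q => A₂ q + t₂) '' fccStacking 1 (Real.sqrt (2 / 3))) :
    ∃ (L : EuclideanSpace ℝ (Fin 3) ≃ₗᵢ[ℝ] EuclideanSpace ℝ (Fin 3))
        (s₁ s₂ : EuclideanSpace ℝ (Fin 3)) (σ σ' : ℤ → ℤ), IsHaggSeq σ ∧ IsHaggSeq σ' ∧
        (fun p => A₁ p + t₁) '' fccStacking 1 (Real.sqrt (2 / 3)) ⊆
          (fun p => L p + s₁) '' barlowStacking 1 (Real.sqrt (2 / 3)) σ ∧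
        (fun p => A₂ p + t₂) '' fccStacking 1 (Real.sqrt (2 / 3)) ⊆
          (fun p => L p + s₂) '' barlowStacking 1 (Real.sqrt (2 / 3)) σ' ∧
    ∃ C R₀ : ℝ, 1 ≤ R₀ ∧ ∀ h : ℝ, 0 ≤ h → ∀ ρ : ℝ, R₀ ≤ ρ →
      ∀ X P₁ P₂ : Finset (EuclideanSpace ℝ (Fin 3)),
      (∀ p ∈ X, ∀ q ∈ X, p ≠ q → 1 ≤ dist p q) → P₁ ⊆ X → P₂ ⊆ X \ P₁ →
      (∀ p ∈ X, -(2 * R₀) ≤ p 2 ∧ p 2 ≤ h + 2 * R₀ ∧ p 0 ^ 2 + p 1 ^ 2 ≤ ρ ^ 2) →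
      (∀ p, p ∈ P₁ ↔ (p ∈ (fun q => A₁ q + t₁) '' fccStacking 1 (Real.sqrt (2 / 3)) ∧
        -(2 * R₀) ≤ p 2 ∧ p 2 ≤ -R₀ ∧ p 0 ^ 2 + p 1 ^ 2 ≤ ρ ^ 2)) →
      (∀ p, p ∈ P₂ ↔ (p ∈ (fun q => A₂ q + t₂) '' fccStacking 1 (Real.sqrt (2 / 3)) ∧
        h + R₀ ≤ p 2 ∧ p 2 ≤ h + 2 * R₀ ∧ p 0 ^ 2 + p 1 ^ 2 ≤ ρ ^ 2)) →
      (∀ p ∈ X, p ∈ (fun q => A₁ q + t₁) '' fccStacking 1 (Real.sqrt (2 / 3)) ∨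
        p ∈ (fun q => A₂ q + t₂) '' fccStacking 1 (Real.sqrt (2 / 3))) →
      ((((P₁ ×ˢ (X \ P₁)).filter fun pq => dist pq.1 pq.2 = 1).card : ℕ) : ℝ) +
        ((((P₂ ×ˢ ((X \ P₁) \ P₂)).filter fun pq => dist pq.1 pq.2 = 1).card : ℕ) : ℝ) ≤
        contactDeficiency ((X \ P₁) \ P₂) +
          (Real.sqrt 2 / 4 * ∑ᶠ w ∈ {w ∈ fccStacking 1 (Real.sqrt (2 / 3)) | ‖w‖ = 1},
              |⟪w, A₁.symm (EuclideanSpace.single (2 : Fin 3) (1 : ℝ))⟫_ℝ| +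
            Real.sqrt 2 / 4 * ∑ᶠ w ∈ {w ∈ fccStacking 1 (Real.sqrt (2 / 3)) | ‖w‖ = 1},
              |⟪w, A₂.symm (EuclideanSpace.single (2 : Fin 3) (1 : ℝ))⟫_ℝ| -
            (1 / 2 : ℝ) * Real.sqrt (1 - ⟪L (EuclideanSpace.single (2 : Fin 3) (1 : ℝ)),
              (EuclideanSpace.single (2 : Fin 3) (1 : ℝ))⟫_ℝ ^ 2)) * Real.pi * ρ ^ 2 +
          C * (1 + h) * ρ := by
  classical
  obtain ⟨L, s₁, s₂, σ, σ', hσ, hσ', hsub₁, hsub₂⟩ := hcoax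
  obtain ⟨C₁, hC₁⟩ := affineSampleDeficit_upper A₁ t₁ 3 (by norm_num)
  obtain ⟨C₂, hC₂⟩ := affineSampleDeficit_upper A₂ t₂ 3 (by norm_num)
  set Cg : ℝ := 120 * Real.sqrt 2 * Real.pi + 3 / 4 * Real.sqrt 2 * Real.pi * (6 * 3 + 16) +
    720 * (4 * 3 + 2) with hCg
  refine ⟨L, s₁, s₂, σ, σ', hσ, hσ', hsub₁, hsub₂, |C₁| + |C₂| + Cg, 3, by norm_num, ?_⟩
  intro h hh ρ hρ X P₁ P₂ hX hP₁X hP₂X₁ hcyl hP₁ hP₂ hrigid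
  set e₃ : EuclideanSpace ℝ (Fin 3) := EuclideanSpace.single (2 : Fin 3) (1 : ℝ) with he₃
  set R : EuclideanSpace ℝ (Fin 3) ≃ₗᵢ[ℝ] EuclideanSpace ℝ (Fin 3) :=
    (ℝ ∙ EuclideanSpace.single (2 : Fin 3) (1 : ℝ)).reflection with hR
  set φ₁ : ℝ := Real.sqrt 2 / 4 * ∑ᶠ w ∈ {w ∈ fccStacking 1 (Real.sqrt (2 / 3)) | ‖w‖ = 1},
      |⟪w, A₁.symm e₃⟫_ℝ| with hφ₁
  set φ₂ : ℝ := Real.sqrt 2 / 4 * ∑ᶠ w ∈ {w ∈ fccStacking 1 (Real.sqrt (2 / 3)) | ‖w‖ = 1},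
      |⟪w, A₂.symm e₃⟫_ℝ| with hφ₂
  have hP₂X : P₂ ⊆ X := hP₂X₁.trans sdiff_subset
  -- the pair is a twin pair in the frame: `σ 0 ≠ σ' 0`
  have htw : σ 0 ≠ σ' 0 := by
    intro heq
    obtain ⟨-, e₁⟩ := linear_image_eq_frame_of_subset A₁ L t₁ s₁ hσ hsub₁
    obtain ⟨-, e₂⟩ := linear_image_eq_frame_of_subset A₂ L t₂ s₂ hσ' hsub₂
    exact htwin (by rw [e₁, e₂, heq])
  -- frame normalisation + absorption, in either order of the two letters
  have hnorm : ∃ M₁ M₂ : EuclideanSpace ℝ (Fin 3) ≃ₗᵢ[ℝ] EuclideanSpace ℝ (Fin 3),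
      (fun q => A₁ q + t₁) '' fccStacking 1 (Real.sqrt (2 / 3)) =
        (fun q => M₁ q + s₁) '' fccStacking 1 (Real.sqrt (2 / 3)) ∧
      (fun q => A₂ q + t₂) '' fccStacking 1 (Real.sqrt (2 / 3)) =
        (fun q => M₂ q + s₂) '' fccStacking 1 (Real.sqrt (2 / 3)) ∧
      M₁ e₃ = L e₃ ∧ M₂ e₃ = L e₃ ∧
      (∀ x ∈ X, x ∈ (fun q => M₁ q + s₁) '' fccStacking 1 (Real.sqrt (2 / 3)) →
        (fccSlots.filter fun w => w 2 = 0 ∧ x + M₁ w ∉ X).card +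
          4 * (X.filter fun q => dist x q = 1).card ≤ 48) ∧
      (∀ x ∈ X, x ∈ (fun q => M₂ q + s₂) '' fccStacking 1 (Real.sqrt (2 / 3)) →
        (fccSlots.filter fun w => w 2 = 0 ∧ x + M₂ w ∉ X).card +
          4 * (X.filter fun q => dist x q = 1).card ≤ 48) := by
    rcases hσ 0 with h1 | hm1
    · -- grain 1 in the fcc word, grain 2 in the twin word
      have hm1' : σ' 0 = -1 := (hσ' 0).resolve_left fun h' => htw (h1.trans h'.symm)
      have e₁ := coaxial_frame_eq_fcc_of_one A₁ t₁ L s₁ hσ hsub₁ h1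
      obtain ⟨e₂, ax₂⟩ := coaxial_frame_eq_fcc_of_neg_one A₂ t₂ L s₂ hσ' hsub₂ hm1'
      have hrigid' := hrigid
      have hdisj' := hdisj
      simp only [e₁, e₂] at hrigid' hdisj'
      refine ⟨L, R.trans L, e₁, e₂, rfl, ax₂, ?_, ?_⟩
      · intro x _ hxΛ
        exact twin_absorption_inPlane_moved L s₁ s₂ X hX hrigid' x hxΛ (hdisj' x hxΛ)
      · intro x _ hxΛ
        have hx' : x ∉ (fun q => L q + s₁) '' fccStacking 1 (Real.sqrt (2 / 3)) :=
          fun h' => hdisj' x h' hxΛ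
        have key := twin_absorption_inPlane_moved' L s₁ s₂ X hX hrigid' x hxΛ hx'
        simpa only [LinearIsometryEquiv.trans_apply] using key
    · -- grain 1 in the twin word, grain 2 in the fcc word
      have h1' : σ' 0 = 1 := (hσ' 0).resolve_right fun h' => htw (hm1.trans h'.symm)
      obtain ⟨e₁, ax₁⟩ := coaxial_frame_eq_fcc_of_neg_one A₁ t₁ L s₁ hσ hsub₁ hm1
      have e₂ := coaxial_frame_eq_fcc_of_one A₂ t₂ L s₂ hσ' hsub₂ h1'
      have hrigid' : ∀ p ∈ X, p ∈ (fun q => L q + s₂) '' fccStacking 1 (Real.sqrt (2 / 3)) ∨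
          p ∈ (fun q => (R.trans L) q + s₁) '' fccStacking 1 (Real.sqrt (2 / 3)) := by
        intro p hp
        have := hrigid p hp
        rw [e₁, e₂] at this
        exact this.symm
      have hdisj' : ∀ p ∈ (fun q => L q + s₂) '' fccStacking 1 (Real.sqrt (2 / 3)),
          p ∉ (fun q => (R.trans L) q + s₁) '' fccStacking 1 (Real.sqrt (2 / 3)) := by
        intro p hp2 hp1
        have := hdisj p
        rw [e₁, e₂] at this
        exact this hp1 hp2
      refine ⟨R.trans L, L, e₁, e₂, ax₁, rfl, ?_, ?_⟩
      · intro x _ hxΛ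
        have hx' : x ∉ (fun q => L q + s₂) '' fccStacking 1 (Real.sqrt (2 / 3)) :=
          fun h' => hdisj' x h' hxΛ
        have key := twin_absorption_inPlane_moved' L s₂ s₁ X hX hrigid' x hxΛ hx'
        simpa only [LinearIsometryEquiv.trans_apply] using key
      · intro x _ hxΛ
        exact twin_absorption_inPlane_moved L s₂ s₁ X hX hrigid' x hxΛ (hdisj' x hxΛ)
  obtain ⟨M₁, M₂, e₁, e₂, ax₁, ax₂, habs₁, habs₂⟩ := hnorm
  -- (1) the two slab samples from above (original presentation)
  have hD₁ := hC₁ (-(2 * 3)) (-3) (by norm_num) ρ hρ P₁ hP₁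
  have hD₂ := hC₂ (h + 3) (h + 2 * 3) (by ring) ρ hρ P₂ hP₂
  -- (2) the two-grain cell ledger (normalised presentation)
  have hP₁' := hP₁
  have hP₂' := hP₂
  have hrigid' := hrigid
  have hdisj' := hdisj
  simp only [e₁, e₂] at hP₁' hP₂' hrigid' hdisj'
  have hcell := coaxial_rigid_cell_ledger M₁ s₁ M₂ s₂ X P₁ P₂ 3 h ρ le_rfl hh hρ hX hcyl hP₁X hP₂X
    hP₁' hP₂' hdisj' hrigid' habs₁ habs₂
  -- the face fluxes and the sines in the crux's terms
  have hf₁ : Real.sqrt 2 / 4 * ∑ w ∈ fccSlots, |⟪M₁ w, e₃⟫_ℝ| = φ₁ := by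
    rw [hφ₁, finsum_unit_fcc_symm_eq_sum_slots, sum_abs_inner_slots_eq_of_movedFcc_eq A₁ M₁ t₁ s₁ e₁]
  have hf₂ : Real.sqrt 2 / 4 * ∑ w ∈ fccSlots, |⟪M₂ w, e₃⟫_ℝ| = φ₂ := by
    rw [hφ₂, finsum_unit_fcc_symm_eq_sum_slots, sum_abs_inner_slots_eq_of_movedFcc_eq A₂ M₂ t₂ s₂ e₂]
  rw [hf₁, hf₂, ax₁, ax₂] at hcell
  -- (3) the two splits of the skeleton
  have hs₁ := contactDeficiency_sdiff_split hP₁X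
  have hs₂ := contactDeficiency_sdiff_split hP₂X₁
  -- (4) assemble
  set S : ℝ := Real.sqrt (1 - ⟪L e₃, e₃⟫_ℝ ^ 2) with hS
  have hS0 : 0 ≤ S * Real.pi * ρ ^ 2 := by positivity
  have hsix : 2 * (S * Real.pi * ρ ^ 2) ≤ Real.sqrt 6 * (S * Real.pi * ρ ^ 2) :=
    mul_le_mul_of_nonneg_right two_le_sqrt_six hS0
  have hρ0 : (0 : ℝ) ≤ ρ := by linarith
  have ha : C₁ * ρ ≤ |C₁| * (1 + h) * ρ := by
    have h1 : C₁ * ρ ≤ |C₁| * ρ := mul_le_mul_of_nonneg_right (le_abs_self _) hρ0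
    have h2 : 0 ≤ |C₁| * h * ρ := by positivity
    nlinarith
  have hb : C₂ * ρ ≤ |C₂| * (1 + h) * ρ := by
    have h1 : C₂ * ρ ≤ |C₂| * ρ := mul_le_mul_of_nonneg_right (le_abs_self _) hρ0
    have h2 : 0 ≤ |C₂| * h * ρ := by positivity
    nlinarith
  have hCg6 : (6 : ℝ) * 3 + 16 = 34 := by norm_num
  have hCg4 : (4 : ℝ) * 3 + 2 = 14 := by norm_num
  rw [hCg6, hCg4] at hcell
  have hC : (|C₁| + |C₂| + Cg) * (1 + h) * ρ =
      |C₁| * (1 + h) * ρ + |C₂| * (1 + h) * ρ + Cg * (1 + h) * ρ := by ring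
  rw [hC]
  have hcell' : (2 * φ₁ + Real.sqrt 6 / 4 * S) * Real.pi * ρ ^ 2 +
      (2 * φ₂ + Real.sqrt 6 / 4 * S) * Real.pi * ρ ^ 2 - 2 * (Cg * (1 + h) * ρ) ≤
      2 * contactDeficiency X := by
    have e : Cg = 120 * Real.sqrt 2 * Real.pi + 3 / 4 * Real.sqrt 2 * Real.pi * 34 + 720 * 14 := by
      rw [hCg]; norm_num
    rw [e]; exact hcell
  linarith [hcell', hD₁, hD₂, hs₁, hs₂, hsix, ha, hb, hS0]

end Summit.Ventures.Crystal3D.Theorems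

end
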